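import Literature.NumberTheory.Sieve.ChenTwinUpperBCardTools
import HarnessLib

/-!
# Chen's theorem, twin form: the cardinality of the enlarged switched set (Nathanson Thm 10.6, step 3)

Topic `Literature/NumberTheory/Sieve`, family `parity`; companion of
`Literature.NumberTheory.Sieve.ChenTwinUpperB`, whose conditional `twin_sieveUpperB_of` reduces
estimate (C) `Literature.NumberTheory.Sieve.Chen.twin_sieveUpperB` to a cardinality bound (`hcard`) and a
remainder bound (`hrem`) for the enlarged set of triples `T̃(x, ε)` (`chenTriplesExt`). This file
PROVES the cardinality bound (everything here is a theorem; no definitions, no named facts):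

* `Literature.NumberTheory.Sieve.Chen.chenTriplesExt_card_bound` — for `0 < ε ≤ 1`, `η > 0` and all
  large `x`, `#T̃(x, ε) ≤ (1 + 2ε)(c + η) x/log x`, `c = switchingConstant`
  (Nathanson, *Additive Number Theory: The Classical Bases*, proof of Thm 10.6, pp. 176–178:
  `|B̃| < (1 + O(ε)) cN/log N + O(N/(log N)²)`).

Proof, following the book with `N − p₁p₂p₃ ↦ p₁p₂p₃ − 2`:
`#T̃ ≤ ∑_{x^{1/8} ≤ p₁ < y} ∑_{y ≤ p₂ < (X₁/p₁)^{1/2}} π(X₁/(p₁p₂))`, `X₁ = (1+ε)(x+2)`,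
`y = (x+3)^{1/3}` (`card_chenTriplesExt_le_sum_primeCounting`, p. 176); the prime number theorem
`π(u) ≤ (1 + ε/4) u/log u` for large `u` (the tree's `eventually_primeCounting_bounds`) and
`log u ≥ log(x/(p₁p₂))` (`primeCounting_floor_le`); and the double prime sum
`∑∑ 1/(p₁p₂ log(x/p₁p₂)) ≤ (c + 16/N + 2100N/L)/L` (`double_prime_sum_le`, `L = log x`, `N`
cells), obtained from the tools of `ChenTwinUpperBCardTools.lean`: the inner sum over `p₂` is
compared with `∫ dα/(α(1 − β − α)) = (log(2 − 3β) + o(1))/(1 − β)` (`β = log p₁/L`; the book's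
`H(p₁)`, p. 177) and the outer sum over `p₁` with `∫_{1/8}^{1/3} log(2 − 3β)/(β(1 − β)) dβ = c`
(p. 178).

## References

* M. B. Nathanson, *Additive Number Theory: The Classical Bases*, GTM 164 (1996), proof of
  Thm 10.6, pp. 176–178 of the held copy. [Nathanson1996]
* Chen Jing-run, Sci. Sinica 16 (1973), 157–176, p. 176 (the twin form). [ChenSciSinica1973]
-/

open Finset Filter Topology

noncomputable section

namespace Literature.NumberTheory.Sieve.Chen

open LFunctions.Mertens

/-! ### The double prime sum `Σ ≤ (c + o(1))/log x` -/

/-- `x^{log y/log x} = y` for `x > 1`, `y > 0`. [folklore] -/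
theorem rpow_log_div_log {X y : ℝ} (hX : 1 < X) (hy : 0 < y) : X ^ (Real.log y / Real.log X) = y := by
  have hX0 : 0 < X := by linarith
  have hL : Real.log X ≠ 0 := (Real.log_pos hX).ne'
  rw [Real.rpow_def_of_pos hX0, mul_div_cancel₀ _ hL, Real.exp_log hy]

set_option maxHeartbeats 400000 in
/-- **The double prime sum of the cardinality computation** (Nathanson, proof of Thm 10.6,
pp. 176–178: the evaluation of `∑_{z ≤ p₁ < y} (1/p₁) ∑_{y ≤ p₂ < (X₁/p₁)^{1/2}} 1/(p₂ log(N/p₁p₂))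
= (c + o(1))/log N`). For `X > 1` with `L = log X ≥ 400`, `X^{1/8} ≥ 3`, a cut-off `Y'` with
`3 ≤ Y'`, `X^{1/3} ≤ Y' ≤ X^{1/3} e^{1/2}` (i.e. `log Y' ≤ (1/3 + 1/(2L)) L`), `X ≤ X₁` with
`log X₁ ≤ L + 4/5`, and every `N ≥ 1`:
`∑_{X^{1/8} ≤ p₁ < Y'} ∑_{Y' ≤ p₂ < (X₁/p₁)^{1/2}} 1/(p₁p₂ log(X/(p₁p₂))) ≤ (c + 16/N + 2100N/L)/L`,
`c = switchingConstant`. Proof: the inner sum is `≤ Ψ(β₁)/L + (4/L)(1/N + 120N/L)` by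
`sum_window_div_le_integral_of_monotoneOn`, `integral_inv_mul_sub_eq` and `inner_integral_le`
(`β₁ = log p₁/L`); the outer sum by `sum_window_div_le_integral_of_antitoneOn` and
`integral_psi_div_le`. [cite: Nathanson1996, Thm 10.6 (proof, pp. 176–178)] -/
theorem double_prime_sum_le {X X₁ Y' : ℝ} {N : ℕ} (hX : 1 < X) (hL : 400 ≤ Real.log X)
    (hz3 : 3 ≤ X ^ (1 / 8 : ℝ)) (hY3 : 3 ≤ Y') (haY : X ^ (1 / 3 : ℝ) ≤ Y')
    (haY' : Real.log Y' ≤ (1 / 3 + 1 / (2 * Real.log X)) * Real.log X) (hX₁ : X ≤ X₁)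
    (hX₁' : Real.log X₁ ≤ Real.log X + 4 / 5) (hN : 0 < N) :
    ∑ p₁ ∈ (Nat.primesBelow ⌈Y'⌉₊).filter (fun p : ℕ => X ^ (1 / 8 : ℝ) ≤ (p : ℝ)),
        ∑ p₂ ∈ (Nat.primesBelow ⌈Real.sqrt (X₁ / p₁)⌉₊).filter (fun p : ℕ => Y' ≤ (p : ℝ)),
          1 / ((p₁ : ℝ) * p₂ * (Real.log X - Real.log p₁ - Real.log p₂)) ≤
      (switchingConstant + 16 / N + 2100 * N / Real.log X) / Real.log X := by
  have hX0 : 0 < X := by linarith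
  have hL0 : 0 < Real.log X := by linarith
  have hL10 : 10 ≤ Real.log X := by linarith
  have hLne : Real.log X ≠ 0 := hL0.ne'
  have hN0 : (0 : ℝ) < N := by exact_mod_cast hN
  have hN1 : (1 : ℝ) ≤ N := by exact_mod_cast hN
  have hY0 : 0 < Y' := by linarith
  have hX₁0 : 0 < X₁ := by linarith
  -- the normalised parameters
  set aY := Real.log Y' / Real.log X with haY_def
  have haY13 : 1 / 3 ≤ aY := by
    rw [haY_def, le_div_iff₀ hL0]
    have h := Real.log_le_log (Real.rpow_pos_of_pos hX0 _) haY
    rwa [Real.log_rpow hX0] at h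
  have haYhi : aY ≤ 1 / 3 + 1 / (2 * Real.log X) := by
    rw [haY_def, div_le_iff₀ hL0]
    exact haY'
  have h2L : 1 / (2 * Real.log X) ≤ 1 / 800 :=
    div_le_div_of_nonneg_left (by norm_num) (by norm_num) (by linarith)
  have haY720 : aY ≤ 7 / 20 := by linarith
  have hXaY : X ^ aY = Y' := rpow_log_div_log hX hY0
  set ℓ₁ := Real.log X₁ / Real.log X with hℓ₁_def
  have hℓ₁1 : 1 ≤ ℓ₁ := by
    rw [hℓ₁_def, le_div_iff₀ hL0, one_mul]
    exact Real.log_le_log hX0 hX₁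
  have hℓ₁hi : ℓ₁ ≤ 1 + 4 / (5 * Real.log X) := by
    rw [hℓ₁_def, div_le_iff₀ hL0]
    have : (1 + 4 / (5 * Real.log X)) * Real.log X = Real.log X + 4 / 5 := by
      field_simp
    rw [this]
    exact hX₁'
  have h45 : 4 / (5 * Real.log X) ≤ 4 / 2000 :=
    div_le_div_of_nonneg_left (by norm_num) (by norm_num) (by linarith)
  set Ψ : ℝ → ℝ := fun β => (Real.log (2 - 3 * β) + 4 / Real.log X) / (1 - β) with hΨ_def
  set E : ℝ := 4 / Real.log X * (1 / N + 120 * N / Real.log X) with hE_def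
  have hE0 : 0 ≤ E := by positivity
  set P₁ := (Nat.primesBelow ⌈Y'⌉₊).filter (fun p : ℕ => X ^ (1 / 8 : ℝ) ≤ (p : ℝ)) with hP₁
  have hmemP₁ : ∀ p ∈ P₁, p.Prime ∧ X ^ (1 / 8 : ℝ) ≤ (p : ℝ) ∧ (p : ℝ) < Y' := fun p hp => by
    rw [hP₁, Finset.mem_filter, Nat.mem_primesBelow] at hp
    exact ⟨hp.1.2, hp.2, Nat.lt_ceil.mp hp.1.1⟩
  -- **the inner sum**
  have hinner : ∀ p₁ ∈ P₁,
      ∑ p₂ ∈ (Nat.primesBelow ⌈Real.sqrt (X₁ / p₁)⌉₊).filter (fun p : ℕ => Y' ≤ (p : ℝ)),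
          1 / ((p₁ : ℝ) * p₂ * (Real.log X - Real.log p₁ - Real.log p₂)) ≤
        1 / (p₁ : ℝ) * (1 / Real.log X * Ψ (Real.log p₁ / Real.log X) + E) := by
    intro p₁ hp₁
    obtain ⟨hp₁prime, hp₁z, hp₁Y⟩ := hmemP₁ p₁ hp₁
    have hp₁0 : (0 : ℝ) < p₁ := lt_of_lt_of_le (by linarith) hp₁z
    set β₁ := Real.log p₁ / Real.log X with hβ₁_def
    have hβ₁lo : 1 / 8 ≤ β₁ := by
      rw [hβ₁_def, le_div_iff₀ hL0]
      have h := Real.log_le_log (Real.rpow_pos_of_pos hX0 _) hp₁z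
      rwa [Real.log_rpow hX0] at h
    have hβ₁hi : β₁ < aY := by
      rw [hβ₁_def, haY_def]
      exact div_lt_div_of_pos_right (Real.log_lt_log hp₁0 hp₁Y) hL0
    have hlogp₁ : Real.log p₁ = β₁ * Real.log X := by rw [hβ₁_def, div_mul_cancel₀ _ hLne]
    -- the window and the weight
    set W := Real.sqrt (X₁ / p₁) with hW_def
    have hW0 : 0 < W := Real.sqrt_pos.mpr (div_pos hX₁0 hp₁0)
    have hlogW : Real.log W / Real.log X = (ℓ₁ - β₁) / 2 := by
      rw [hW_def, Real.log_sqrt (div_pos hX₁0 hp₁0).le, Real.log_div hX₁0.ne' hp₁0.ne', hℓ₁_def,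
        hβ₁_def]
      field_simp
    have hXbW : X ^ ((ℓ₁ - β₁) / 2) = W := by rw [← hlogW]; exact rpow_log_div_log hX hW0
    set G₁ : ℝ → ℝ := fun α => 1 / (Real.log X - Real.log p₁ - Real.log X * α) with hG₁_def
    have hden : ∀ α : ℝ, Real.log X - Real.log p₁ - Real.log X * α = Real.log X * (1 - β₁ - α) := by
      intro α; rw [hlogp₁]; ring
    have hgap : 1 / 4 ≤ 1 - β₁ - (ℓ₁ - β₁) / 2 := by linarith
    -- rewrite the summand
    have hsummand : ∀ p₂ : ℕ, 1 / ((p₁ : ℝ) * p₂ * (Real.log X - Real.log p₁ - Real.log p₂)) =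
        1 / (p₁ : ℝ) * (G₁ (Real.log p₂ / Real.log X) / p₂) := by
      intro p₂
      simp only [hG₁_def]
      rw [mul_div_cancel₀ _ hLne]
      simp only [mul_inv, div_eq_mul_inv]
      ring
    rw [Finset.sum_congr rfl fun p₂ _ => hsummand p₂, ← Finset.mul_sum]
    refine mul_le_mul_of_nonneg_left ?_ (by positivity)
    -- `Ψ(β₁) ≥ 0`
    have hΨ0 : 0 ≤ Ψ β₁ := by
      rw [hΨ_def]
      exact psi_nonneg hL10 (by linarith)
    rcases le_or_gt W Y' with hWY | hWY
    · -- empty window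
      have hempty : (Nat.primesBelow ⌈W⌉₊).filter (fun p : ℕ => Y' ≤ (p : ℝ)) = ∅ := by
        refine Finset.filter_false_of_mem fun p hp => ?_
        rw [Nat.mem_primesBelow, Nat.lt_ceil] at hp
        exact not_le.mpr (lt_of_lt_of_le hp.1 hWY)
      rw [hempty, Finset.sum_empty]
      exact add_nonneg (mul_nonneg (by positivity) hΨ0) hE0
    -- nonempty window: `aY < (ℓ₁ - β₁)/2`
    have hab : aY < (ℓ₁ - β₁) / 2 := by
      rw [← hlogW, haY_def]
      exact div_lt_div_of_pos_right (Real.log_lt_log hY0 hWY) hL0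
    have hmono : MonotoneOn G₁ (Set.Icc aY ((ℓ₁ - β₁) / 2)) := by
      intro α hα α' hα' hαα'
      simp only [hG₁_def]
      rw [hden α, hden α']
      refine one_div_le_one_div_of_le ?_ ?_
      · have : 1 / 4 ≤ 1 - β₁ - α' := by linarith only [hα'.2, hgap]
        positivity
      · exact mul_le_mul_of_nonneg_left (by linarith only [hαα']) hL0.le
    have hG0 : ∀ α ∈ Set.Icc aY ((ℓ₁ - β₁) / 2), 0 ≤ G₁ α := fun α hα => by
      simp only [hG₁_def]
      rw [hden α]
      have : 1 / 4 ≤ 1 - β₁ - α := by linarith [hα.2]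
      positivity
    have hGM : ∀ α ∈ Set.Icc aY ((ℓ₁ - β₁) / 2), G₁ α ≤ 4 / Real.log X := fun α hα => by
      simp only [hG₁_def]
      rw [hden α]
      have h14 : 1 / 4 ≤ 1 - β₁ - α := by linarith only [hα.2, hgap]
      rw [div_le_div_iff₀ (by positivity) hL0]
      have := mul_le_mul_of_nonneg_left h14 hL0.le
      linarith only [this]
    have key := sum_window_div_le_integral_of_monotoneOn (βa := aY) (βb := (ℓ₁ - β₁) / 2)
      hX (by linarith) hab.le (by rw [hXaY]; exact hY3) hmono hG0 hGM hN
    rw [hXbW, hXaY] at key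
    -- the integral
    have hint : ∫ α in aY..(ℓ₁ - β₁) / 2, G₁ α / α =
        1 / Real.log X * ((Real.log ((ℓ₁ - β₁) / 2 / (1 - β₁ - (ℓ₁ - β₁) / 2)) -
          Real.log (aY / (1 - β₁ - aY))) / (1 - β₁)) := by
      rw [← integral_inv_mul_sub_eq (by linarith) hab.le (by linarith),
        ← intervalIntegral.integral_const_mul]
      refine intervalIntegral.integral_congr fun α _ => ?_
      simp only [hG₁_def]
      rw [hden α]
      simp only [mul_inv, div_eq_mul_inv]
      ring
    have hI := inner_integral_le hL10 hβ₁lo hβ₁hi haY13 haY720 hℓ₁1 hℓ₁hi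
    have hint' : ∫ α in aY..(ℓ₁ - β₁) / 2, G₁ α / α ≤ 1 / Real.log X * Ψ β₁ := by
      rw [hint, hΨ_def]
      exact mul_le_mul_of_nonneg_left hI (by positivity)
    -- the error terms
    have herr1 : Real.log ((ℓ₁ - β₁) / 2 / aY) ≤ 1 := by
      have hpos : 0 < (ℓ₁ - β₁) / 2 / aY := div_pos (by linarith) (by linarith)
      have h1 : (ℓ₁ - β₁) / 2 / aY ≤ 2 := by
        rw [div_le_iff₀ (by linarith)]
        linarith
      calc Real.log ((ℓ₁ - β₁) / 2 / aY) ≤ (ℓ₁ - β₁) / 2 / aY - 1 := Real.log_le_sub_one_of_pos hpos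
        _ ≤ 1 := by linarith
    have herr2 : 40 * N / (aY * Real.log X) ≤ 120 * N / Real.log X := by
      rw [div_le_div_iff₀ (by positivity) hL0]
      have := mul_le_mul_of_nonneg_left haY13 (mul_pos hN0 hL0).le
      nlinarith only [this]
    have herr : 4 / Real.log X * (Real.log ((ℓ₁ - β₁) / 2 / aY) / N + 40 * N / (aY * Real.log X)) ≤ E := by
      rw [hE_def]
      refine mul_le_mul_of_nonneg_left (add_le_add ?_ herr2) (by positivity)
      exact div_le_div_of_nonneg_right herr1 hN0.le
    linarith [key, hint', herr]
  -- **the outer sum**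
  have houter : ∑ p₁ ∈ P₁, 1 / (p₁ : ℝ) * (1 / Real.log X * Ψ (Real.log p₁ / Real.log X) + E) =
      1 / Real.log X * ∑ p₁ ∈ P₁, Ψ (Real.log p₁ / Real.log X) / p₁ + E * ∑ p₁ ∈ P₁, (1 : ℝ) / p₁ := by
    rw [Finset.mul_sum, Finset.mul_sum, ← Finset.sum_add_distrib]
    refine Finset.sum_congr rfl fun p _ => ?_
    ring
  have hΨanti : AntitoneOn Ψ (Set.Icc (1 / 8) aY) := by
    rw [hΨ_def]; exact psi_antitoneOn hL10 haY720
  have hΨ0 : ∀ β ∈ Set.Icc (1 / 8) aY, 0 ≤ Ψ β := fun β hβ => by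
    rw [hΨ_def]; exact psi_nonneg hL10 (by linarith [hβ.2])
  have hΨ2 : ∀ β ∈ Set.Icc (1 / 8) aY, Ψ β ≤ 2 := fun β hβ => by
    rw [hΨ_def]; exact psi_le_two hL10 hβ.1 (by linarith [hβ.2])
  have key2 := sum_window_div_le_integral_of_antitoneOn (βa := 1 / 8) (βb := aY) (M := 2)
    hX (by norm_num) (by linarith) hz3 hΨanti hΨ0 hΨ2 hN
  rw [hXaY] at key2
  have hIΨ : ∫ β in (1 / 8 : ℝ)..aY, Ψ β / β ≤ switchingConstant + 16 / Real.log X := by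
    rw [hΨ_def]; exact integral_psi_div_le hL10 haY13 haY720
  have hlog8 : Real.log (aY / (1 / 8)) ≤ 9 / 5 := by
    have hpos : 0 < aY / (1 / 8) := by positivity
    calc Real.log (aY / (1 / 8)) ≤ aY / (1 / 8) - 1 := Real.log_le_sub_one_of_pos hpos
      _ ≤ 9 / 5 := by rw [div_div_eq_mul_div]; linarith
  have hΨsum : ∑ p₁ ∈ P₁, Ψ (Real.log p₁ / Real.log X) / p₁ ≤
      switchingConstant + 16 / Real.log X + 2 * ((9 / 5) / N + 320 * N / Real.log X) := by
    refine key2.trans (add_le_add hIΨ (mul_le_mul_of_nonneg_left (add_le_add ?_ ?_) (by norm_num)))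
    · exact div_le_div_of_nonneg_right hlog8 hN0.le
    · rw [show 40 * (N : ℝ) / (1 / 8 * Real.log X) = 320 * N / Real.log X by
        field_simp; ring]
  -- `∑ 1/p₁ ≤ 3`
  have hrecip : ∑ p₁ ∈ P₁, (1 : ℝ) / p₁ ≤ 3 := by
    have hz_le_Y : X ^ (1 / 8 : ℝ) ≤ Y' :=
      le_trans (Real.rpow_le_rpow_of_exponent_le hX.le (by norm_num)) haY
    have h := sum_inv_primes_window_le hz3 hz_le_Y
    rw [Real.log_rpow hX0] at h
    have h1 : Real.log (Real.log Y' / (1 / 8 * Real.log X)) = Real.log (aY / (1 / 8)) := by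
      rw [haY_def]; congr 1; field_simp
    rw [h1] at h
    have h2 : 40 / (1 / 8 * Real.log X) ≤ 1 := by
      rw [div_le_one (by positivity)]; linarith
    linarith
  -- assemble
  have hc0 : 0 ≤ switchingConstant := switchingConstant_nonneg
  have hΨsum0 : 0 ≤ ∑ p₁ ∈ P₁, Ψ (Real.log p₁ / Real.log X) / p₁ :=
    Finset.sum_nonneg fun p hp => by
      obtain ⟨-, hpz, hpY⟩ := hmemP₁ p hp
      have hp0 : (0 : ℝ) < p := lt_of_lt_of_le (by linarith) hpz
      refine div_nonneg (hΨ0 _ ⟨?_, ?_⟩) hp0.le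
      · rw [le_div_iff₀ hL0]
        have h := Real.log_le_log (Real.rpow_pos_of_pos hX0 _) hpz
        rwa [Real.log_rpow hX0] at h
      · rw [haY_def]
        exact (div_lt_div_of_pos_right (Real.log_lt_log hp0 hpY) hL0).le
  calc ∑ p₁ ∈ P₁, ∑ p₂ ∈ (Nat.primesBelow ⌈Real.sqrt (X₁ / p₁)⌉₊).filter (fun p : ℕ => Y' ≤ (p : ℝ)),
          1 / ((p₁ : ℝ) * p₂ * (Real.log X - Real.log p₁ - Real.log p₂))
      ≤ ∑ p₁ ∈ P₁, 1 / (p₁ : ℝ) * (1 / Real.log X * Ψ (Real.log p₁ / Real.log X) + E) :=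
        Finset.sum_le_sum hinner
    _ = 1 / Real.log X * ∑ p₁ ∈ P₁, Ψ (Real.log p₁ / Real.log X) / p₁ +
          E * ∑ p₁ ∈ P₁, (1 : ℝ) / p₁ := houter
    _ ≤ 1 / Real.log X * (switchingConstant + 16 / Real.log X + 2 * ((9 / 5) / N + 320 * N / Real.log X)) +
          E * 3 :=
        add_le_add (mul_le_mul_of_nonneg_left hΨsum (by positivity)) (mul_le_mul_of_nonneg_left hrecip hE0)
    _ ≤ (switchingConstant + 16 / N + 2100 * N / Real.log X) / Real.log X := by
        rw [le_div_iff₀ hL0]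
        have hNne : (N : ℝ) ≠ 0 := hN0.ne'
        have hexp : (1 / Real.log X * (switchingConstant + 16 / Real.log X +
            2 * ((9 / 5) / N + 320 * N / Real.log X)) + E * 3) * Real.log X =
            switchingConstant + 16 / Real.log X + 18 / 5 / N + 640 * N / Real.log X +
              12 * (1 / N + 120 * N / Real.log X) := by
          rw [hE_def]
          field_simp
          ring
        rw [hexp]
        have hdiff : (switchingConstant + 16 / N + 2100 * N / Real.log X) -
            (switchingConstant + 16 / Real.log X + 18 / 5 / N + 640 * N / Real.log X +
              12 * (1 / N + 120 * N / Real.log X)) = 2 / 5 / N + (20 * N - 16) / Real.log X := by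
          field_simp
          ring
        have h20 : 0 ≤ (20 * N - 16) / Real.log X := div_nonneg (by linarith) hL0.le
        have hN' : 0 ≤ (2 : ℝ) / 5 / N := by positivity
        linarith only [hdiff, h20, hN']

/-! ### From `T̃(x, ε)` to the double prime sum -/

/-- For `t = (p₁, p₂, p₃) ∈ T̃(x, ε)`: `p₁p₂p₃ < (1 + ε)(x + 2)` (as `p₁ < (1+ε)ℓ(p₁)`).
[cite: Nathanson1996, Thm 10.6 (proof, (10.14))] -/
theorem prod_lt_of_mem_chenTriplesExt {x : ℕ} {ε : ℝ} (hx : 0 < x) (hε : 0 < ε) {t : ℕ × ℕ × ℕ}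
    (ht : t ∈ chenTriplesExt x ε) : ((t.1 * t.2.1 * t.2.2 : ℕ) : ℝ) < (1 + ε) * ((x : ℝ) + 2) := by
  obtain ⟨-, -, h₂, h₃, hz, -, -, -, hle⟩ := mem_chenTriplesExt.mp ht
  have hp : (x : ℝ) ^ (1 / 8 : ℝ) ≤ t.1 := twinZ_le_iff.mp hz
  have hlt := lt_mul_chenGridPoint hx hε hp
  have hℓ := chenGridPoint_pos hx hε t.1
  have h23 : (0 : ℝ) < (t.2.1 : ℝ) * t.2.2 := by
    have := h₂.pos; have := h₃.pos; positivity
  push_cast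
  calc (t.1 : ℝ) * t.2.1 * t.2.2 = (t.1 : ℝ) * ((t.2.1 : ℝ) * t.2.2) := by ring
    _ < (1 + ε) * chenGridPoint x ε t.1 * ((t.2.1 : ℝ) * t.2.2) := by gcongr
    _ = (1 + ε) * (chenGridPoint x ε t.1 * t.2.1 * t.2.2) := by ring
    _ ≤ (1 + ε) * ((x : ℝ) + 2) := by gcongr

/-- **`#T̃ ≤ ∑_{p₁} ∑_{p₂} π(X₁/(p₁p₂))`** (Nathanson p. 176: `|B̃| ≤ ∑_{z ≤ p₁ < y ≤ p₂, p₁p₂² < (1+ε)N}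
π((1+ε)N/(p₁p₂))`): the triples of `T̃(x, ε)` with first coordinates `p₁, p₂` inject by `p₃` into the
primes `≤ X₁/(p₁p₂)`, `X₁ = (1+ε)(x+2)`, and `p₂ < (X₁/p₁)^{1/2}`.
[cite: Nathanson1996, Thm 10.6 (proof, p. 176)] -/
theorem card_chenTriplesExt_le_sum_primeCounting {x : ℕ} {ε : ℝ} (hx : 0 < x) (hε : 0 < ε) :
    #(chenTriplesExt x ε) ≤
      ∑ p₁ ∈ (Nat.primesBelow (twinY x)).filter (fun p : ℕ => (x : ℝ) ^ (1 / 8 : ℝ) ≤ (p : ℝ)),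
        ∑ p₂ ∈ (Nat.primesBelow ⌈Real.sqrt ((1 + ε) * ((x : ℝ) + 2) / p₁)⌉₊).filter
            (fun p : ℕ => ((x : ℝ) + 3) ^ (1 / 3 : ℝ) ≤ (p : ℝ)),
          Nat.primeCounting ⌊(1 + ε) * ((x : ℝ) + 2) / (p₁ * p₂)⌋₊ := by
  classical
  set T := chenTriplesExt x ε with hT
  set X₁ := (1 + ε) * ((x : ℝ) + 2) with hX₁
  set P₁ := (Nat.primesBelow (twinY x)).filter (fun p : ℕ => (x : ℝ) ^ (1 / 8 : ℝ) ≤ (p : ℝ)) with hP₁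
  set P₂ : ℕ → Finset ℕ := fun p₁ => (Nat.primesBelow ⌈Real.sqrt (X₁ / p₁)⌉₊).filter
    (fun p : ℕ => ((x : ℝ) + 3) ^ (1 / 3 : ℝ) ≤ (p : ℝ)) with hP₂
  have hX₁0 : 0 < X₁ := by rw [hX₁]; positivity
  -- fibres over `p₁`
  have hmaps1 : ((T : Finset (ℕ × ℕ × ℕ)) : Set (ℕ × ℕ × ℕ)).MapsTo (fun t => t.1) (P₁ : Set ℕ) := by
    intro t ht
    have ht' : t ∈ T := ht
    obtain ⟨-, h₁, -, -, hz, hy, -⟩ := mem_chenTriplesExt.mp ht'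
    show t.1 ∈ P₁
    rw [hP₁, Finset.mem_filter, Nat.mem_primesBelow]
    exact ⟨⟨hy, h₁⟩, twinZ_le_iff.mp hz⟩
  rw [Finset.card_eq_sum_card_fiberwise hmaps1]
  refine Finset.sum_le_sum fun p₁ hp₁ => ?_
  have hp₁0 : (0 : ℝ) < p₁ := by
    rw [hP₁, Finset.mem_filter, Nat.mem_primesBelow] at hp₁
    exact_mod_cast hp₁.1.2.pos
  -- fibres over `p₂`
  set T₁ := T.filter (fun t : ℕ × ℕ × ℕ => t.1 = p₁) with hT₁
  have hmaps2 : ((T₁ : Finset (ℕ × ℕ × ℕ)) : Set (ℕ × ℕ × ℕ)).MapsTo (fun t => t.2.1) (P₂ p₁ : Set ℕ) := by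
    intro t ht
    have ht' : t ∈ T₁ := ht
    rw [hT₁, Finset.mem_filter] at ht'
    obtain ⟨htT, ht1⟩ := ht'
    obtain ⟨-, -, h₂, -, -, -, hy', h23, -⟩ := mem_chenTriplesExt.mp htT
    have hprod := prod_lt_of_mem_chenTriplesExt hx hε htT
    rw [ht1] at hprod
    show t.2.1 ∈ P₂ p₁
    rw [hP₂]
    simp only
    rw [Finset.mem_filter, Nat.mem_primesBelow, Nat.lt_ceil]
    have hyr : (twinY x : ℝ) ≤ t.2.1 := by exact_mod_cast hy'
    have hyc : ((x : ℝ) + 3) ^ (1 / 3 : ℝ) ≤ (twinY x : ℝ) := Nat.le_ceil _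
    refine ⟨⟨?_, h₂⟩, le_trans hyc hyr⟩
    refine (Real.lt_sqrt (Nat.cast_nonneg _)).mpr ?_
    rw [lt_div_iff₀ hp₁0]
    have h23r : (t.2.1 : ℝ) ≤ t.2.2 := by exact_mod_cast h23
    have h20 : (0 : ℝ) ≤ t.2.1 := Nat.cast_nonneg _
    calc (t.2.1 : ℝ) ^ 2 * p₁ = (p₁ : ℝ) * t.2.1 * t.2.1 := by ring
      _ ≤ (p₁ : ℝ) * t.2.1 * t.2.2 := by gcongr
      _ = ((p₁ * t.2.1 * t.2.2 : ℕ) : ℝ) := by push_cast; ring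
      _ < X₁ := hprod
  rw [Finset.card_eq_sum_card_fiberwise hmaps2]
  refine Finset.sum_le_sum fun p₂ hp₂ => ?_
  have hp₂0 : (0 : ℝ) < p₂ := by
    rw [hP₂] at hp₂
    simp only at hp₂
    rw [Finset.mem_filter, Nat.mem_primesBelow] at hp₂
    exact_mod_cast hp₂.1.2.pos
  -- inject by `p₃`
  rw [← Nat.primesLE_card_eq_primeCounting]
  refine Finset.card_le_card_of_injOn (fun t : ℕ × ℕ × ℕ => t.2.2) ?_ ?_
  · intro t ht
    have ht' : t ∈ T₁.filter (fun t : ℕ × ℕ × ℕ => t.2.1 = p₂) := ht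
    rw [Finset.mem_filter, hT₁, Finset.mem_filter] at ht'
    obtain ⟨⟨htT, ht1⟩, ht2⟩ := ht'
    obtain ⟨-, -, -, h₃, -⟩ := mem_chenTriplesExt.mp htT
    have hprod := prod_lt_of_mem_chenTriplesExt hx hε htT
    rw [ht1, ht2] at hprod
    show t.2.2 ∈ Nat.primesLE ⌊X₁ / (p₁ * p₂)⌋₊
    rw [Nat.mem_primesLE]
    refine ⟨?_, h₃⟩
    have hlt : (t.2.2 : ℝ) < X₁ / (p₁ * p₂) := by
      rw [lt_div_iff₀ (mul_pos hp₁0 hp₂0)]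
      calc (t.2.2 : ℝ) * (p₁ * p₂) = ((p₁ * p₂ * t.2.2 : ℕ) : ℝ) := by push_cast; ring
        _ < X₁ := hprod
    have h1 : t.2.2 < ⌈X₁ / (p₁ * p₂)⌉₊ := Nat.lt_ceil.mpr hlt
    have h2 := Nat.ceil_le_floor_add_one (X₁ / (p₁ * p₂))
    omega
  · intro t ht t' ht' h
    have htm : t ∈ T₁.filter (fun t : ℕ × ℕ × ℕ => t.2.1 = p₂) := ht
    have htm' : t' ∈ T₁.filter (fun t : ℕ × ℕ × ℕ => t.2.1 = p₂) := ht'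
    rw [Finset.mem_filter, hT₁, Finset.mem_filter] at htm htm'
    simp only at h
    refine Prod.ext ?_ (Prod.ext ?_ h)
    · rw [htm.1.2, htm'.1.2]
    · rw [htm.2, htm'.2]

/-- **The prime number theorem step** (Nathanson p. 176: "`π((1+ε)N/(p₁p₂)) < (1+2ε)N/(p₁p₂ log(N/p₁p₂))`
for `N ≥ N(ε)`"): if `π(m) ≤ (1 + η₁) m/log m` for all `m ≥ N₀`, then for `1 < v ≤ u` with
`u ≥ N₀ + 3`, `π(⌊u⌋) ≤ (1 + η₁) u/log v` (using that `t/log t` increases on `[e, ∞)`).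
[cite: Nathanson1996, Thm 10.6 (proof, p. 176)] -/
theorem primeCounting_floor_le {η₁ : ℝ} (hη₁ : 0 ≤ η₁) {N₀ : ℕ}
    (hPNT : ∀ m : ℕ, N₀ ≤ m → (Nat.primeCounting m : ℝ) ≤ (1 + η₁) * ((m : ℝ) / Real.log m))
    {u v : ℝ} (hv : 1 < v) (hvu : v ≤ u) (hu : (N₀ : ℝ) + 3 ≤ u) :
    (Nat.primeCounting ⌊u⌋₊ : ℝ) ≤ (1 + η₁) * u / Real.log v := by
  set n := ⌊u⌋₊ with hn
  have hN₀0 : (0 : ℝ) ≤ N₀ := Nat.cast_nonneg _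
  have hu0 : 0 ≤ u := by linarith
  have hn_le : (n : ℝ) ≤ u := Nat.floor_le hu0
  have hn_gt : u < n + 1 := Nat.lt_floor_add_one u
  have hnN₀ : N₀ ≤ n := by
    have : (N₀ : ℝ) < n := by linarith
    exact_mod_cast this.le
  have hn3 : 3 ≤ n := Nat.le_floor (by push_cast; linarith)
  have hn3r : (3 : ℝ) ≤ n := by exact_mod_cast hn3
  have hπ := hPNT n hnN₀
  have he1 : Real.exp 1 ≤ (n : ℝ) := le_trans Real.exp_one_lt_d9.le (by linarith)
  have heu : Real.exp 1 ≤ u := he1.trans hn_le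
  have hmono := Real.log_div_self_antitoneOn he1 heu hn_le
  simp only at hmono
  have hn0 : (0 : ℝ) < n := by linarith
  have hu0' : 0 < u := by linarith
  have hlogn : 0 < Real.log n := Real.log_pos (by linarith)
  have hlogu : 0 < Real.log u := Real.log_pos (by linarith)
  have h1 : (n : ℝ) / Real.log n ≤ u / Real.log u := by
    rw [div_le_div_iff₀ hlogn hlogu]
    rw [div_le_div_iff₀ hu0' hn0] at hmono
    linarith
  have h2 : u / Real.log u ≤ u / Real.log v :=
    div_le_div_of_nonneg_left hu0 (Real.log_pos hv) (Real.log_le_log (by linarith) hvu)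
  calc (Nat.primeCounting n : ℝ) ≤ (1 + η₁) * ((n : ℝ) / Real.log n) := hπ
    _ ≤ (1 + η₁) * (u / Real.log v) := mul_le_mul_of_nonneg_left (h1.trans h2) (by linarith)
    _ = (1 + η₁) * u / Real.log v := by ring

/-! ### The cardinality bound -/

set_option maxHeartbeats 400000 in
/-- **The cardinality of the enlarged switched set** (step 3 of the proof of Nathanson's Thm 10.6,
p. 178: `|B̃| < (1 + O(ε)) cN/log N + O(N/(log N)²)`), in the form of hypothesis `hcard` of
`Literature.NumberTheory.Sieve.Chen.twin_sieveUpperB_of`: for `0 < ε ≤ 1`, `η > 0` and all large `x`,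
`#T̃(x, ε) ≤ (1 + 2ε)(c + η) x/log x`, `c = switchingConstant`. Proof:
`#T̃ ≤ ∑_{p₁}∑_{p₂} π(X₁/(p₁p₂))` (`card_chenTriplesExt_le_sum_primeCounting`), the prime number
theorem with `η₁ = ε/4` (`primeCounting_floor_le`), the double prime sum
(`double_prime_sum_le`, `N = ⌈32/η⌉` cells), and `(1 + ε/4)(1 + ε)(x + 2) ≤ (1 + 2ε)x` for `x ≥ 10/ε`.
[cite: Nathanson1996, Thm 10.6 (proof, pp. 176–178)] -/
theorem chenTriplesExt_card_bound (ε : ℝ) (hε : 0 < ε) (hε1 : ε ≤ 1) (η : ℝ) (hη : 0 < η) :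
    ∀ᶠ x : ℕ in atTop,
      (#(chenTriplesExt x ε) : ℝ) ≤ (1 + 2 * ε) * (switchingConstant + η) * x / Real.log x := by
  -- the prime number theorem with `η₁ = ε/4`
  have hη₁ : 0 < ε / 4 := by positivity
  obtain ⟨N₀, hN₀⟩ := eventually_atTop.mp (eventually_primeCounting_bounds hη₁)
  have hPNT : ∀ m : ℕ, N₀ ≤ m → (Nat.primeCounting m : ℝ) ≤ (1 + ε / 4) * ((m : ℝ) / Real.log m) :=
    fun m hm => (hN₀ m hm).2
  -- the number of cells
  set N : ℕ := ⌈32 / η⌉₊ with hNdef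
  have hN32 : 32 / η ≤ N := Nat.le_ceil _
  have hN0 : (0 : ℝ) < N := lt_of_lt_of_le (by positivity) hN32
  have hN : 0 < N := by exact_mod_cast hN0
  have h16N : 16 / (N : ℝ) ≤ η / 2 := by
    rw [div_le_iff₀ hN0]
    have := (div_le_iff₀ hη).mp hN32
    linarith
  -- eventual conditions
  have hlog := (Real.tendsto_log_atTop.comp tendsto_natCast_atTop_atTop).eventually_ge_atTop
    (max 400 (4200 * N / η))
  filter_upwards [hlog, eventually_ge_atTop 6561, eventually_ge_atTop ⌈10 / ε⌉₊,
    eventually_ge_atTop ((N₀ + 3) ^ 3)] with x hlogx hx hxε hxN₀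
  have hlogx' : max 400 (4200 * N / η) ≤ Real.log x := hlogx
  have hL400 : 400 ≤ Real.log x := le_trans (le_max_left _ _) hlogx'
  have hLN : 4200 * N / η ≤ Real.log x := le_trans (le_max_right _ _) hlogx'
  have hxpos : 0 < x := by omega
  have hX1 : (1 : ℝ) < x := by exact_mod_cast (show 1 < x by omega)
  have hX0 : (0 : ℝ) < x := by linarith
  have hX40 : (40 : ℝ) ≤ x := by exact_mod_cast (show 40 ≤ x by omega)
  have hL0 : 0 < Real.log x := by linarith
  have hxε' : 10 / ε ≤ (x : ℝ) := le_trans (Nat.le_ceil _) (by exact_mod_cast hxε)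
  have hεx : 10 ≤ ε * x := by
    rw [div_le_iff₀ hε] at hxε'
    linarith
  have hY'0 : 0 < ((x : ℝ) + 3) ^ (1 / 3 : ℝ) := Real.rpow_pos_of_pos (by positivity) _
  have hz3 : 3 ≤ (x : ℝ) ^ (1 / 8 : ℝ) := by
    rw [show (3 : ℝ) = ((3 : ℝ) ^ (8 : ℕ)) ^ (1 / 8 : ℝ) by
      rw [← Real.rpow_natCast, ← Real.rpow_mul (by norm_num)]; norm_num]
    exact Real.rpow_le_rpow (by norm_num) (by exact_mod_cast hx) (by norm_num)
  have hx13 : (x : ℝ) ^ (1 / 3 : ℝ) ≤ ((x : ℝ) + 3) ^ (1 / 3 : ℝ) :=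
    Real.rpow_le_rpow hX0.le (by linarith) (by norm_num)
  have hz_le : (x : ℝ) ^ (1 / 8 : ℝ) ≤ (x : ℝ) ^ (1 / 3 : ℝ) :=
    Real.rpow_le_rpow_of_exponent_le hX1.le (by norm_num)
  have h3x13 : 3 ≤ (x : ℝ) ^ (1 / 3 : ℝ) := hz3.trans hz_le
  have hY3 : 3 ≤ ((x : ℝ) + 3) ^ (1 / 3 : ℝ) := h3x13.trans hx13
  have hYN₀ : (N₀ : ℝ) + 3 ≤ ((x : ℝ) + 3) ^ (1 / 3 : ℝ) := by
    have h1 : (((N₀ + 3) ^ 3 : ℕ) : ℝ) ≤ x := by exact_mod_cast hxN₀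
    have h2 : ((((N₀ + 3) ^ 3 : ℕ) : ℝ)) ^ (1 / 3 : ℝ) ≤ (x : ℝ) ^ (1 / 3 : ℝ) :=
      Real.rpow_le_rpow (by positivity) h1 (by norm_num)
    have h3 : ((((N₀ + 3) ^ 3 : ℕ) : ℝ)) ^ (1 / 3 : ℝ) = N₀ + 3 := by
      push_cast
      rw [← Real.rpow_natCast, ← Real.rpow_mul (by positivity)]
      norm_num
    linarith
  have haY' : Real.log (((x : ℝ) + 3) ^ (1 / 3 : ℝ)) ≤ (1 / 3 + 1 / (2 * Real.log x)) * Real.log x := by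
    rw [Real.log_rpow (by positivity)]
    have h1 : Real.log ((x : ℝ) + 3) ≤ Real.log x + 3 / x := by
      have h2 : Real.log ((x : ℝ) + 3) - Real.log x = Real.log (1 + 3 / x) := by
        rw [← Real.log_div (by positivity) hX0.ne']
        congr 1
        field_simp
      have h3 : Real.log (1 + 3 / x) ≤ (1 + 3 / x) - 1 := Real.log_le_sub_one_of_pos (by positivity)
      linarith
    have h3 : 3 / (x : ℝ) ≤ 3 / 2 := div_le_div_of_nonneg_left (by norm_num) (by norm_num) (by linarith)
    have h4 : (1 / 3 + 1 / (2 * Real.log x)) * Real.log x = Real.log x / 3 + 1 / 2 := by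
      field_simp
    rw [h4]
    linarith
  have hX₁0 : 0 < (1 + ε) * ((x : ℝ) + 2) := by positivity
  have hX₁ge : (x : ℝ) ≤ (1 + ε) * ((x : ℝ) + 2) := by nlinarith
  have hX₁le : (1 + ε) * ((x : ℝ) + 2) ≤ 21 / 10 * x := by nlinarith
  have hX₁' : Real.log ((1 + ε) * ((x : ℝ) + 2)) ≤ Real.log x + 4 / 5 := by
    have h1 : Real.log ((1 + ε) * ((x : ℝ) + 2)) ≤ Real.log (21 / 10 * x) :=
      Real.log_le_log hX₁0 hX₁le
    rw [Real.log_mul (by norm_num) hX0.ne'] at h1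
    have h2 : Real.log (21 / 10 : ℝ) ≤ 4 / 5 := by
      have h3 : Real.log (21 / 10 : ℝ) = Real.log 2 + Real.log (21 / 20) := by
        rw [← Real.log_mul (by norm_num) (by norm_num)]
        norm_num
      have h4 : Real.log (21 / 20 : ℝ) ≤ 21 / 20 - 1 := Real.log_le_sub_one_of_pos (by norm_num)
      have h5 := Real.log_two_lt_d9
      linarith
    linarith
  -- the sets
  set P₁ := (Nat.primesBelow (twinY x)).filter (fun p : ℕ => (x : ℝ) ^ (1 / 8 : ℝ) ≤ (p : ℝ)) with hP₁
  set P₂ : ℕ → Finset ℕ := fun p₁ =>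
    (Nat.primesBelow ⌈Real.sqrt ((1 + ε) * ((x : ℝ) + 2) / p₁)⌉₊).filter
      (fun p : ℕ => ((x : ℝ) + 3) ^ (1 / 3 : ℝ) ≤ (p : ℝ)) with hP₂
  have hmemP₁ : ∀ p ∈ P₁, p.Prime ∧ (x : ℝ) ^ (1 / 8 : ℝ) ≤ (p : ℝ) ∧
      (p : ℝ) < ((x : ℝ) + 3) ^ (1 / 3 : ℝ) := fun p hp => by
    rw [hP₁, Finset.mem_filter, Nat.mem_primesBelow] at hp
    exact ⟨hp.1.2, hp.2, Nat.lt_ceil.mp hp.1.1⟩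
  have hmemP₂ : ∀ p₁ : ℕ, ∀ p ∈ P₂ p₁, p.Prime ∧ ((x : ℝ) + 3) ^ (1 / 3 : ℝ) ≤ (p : ℝ) ∧
      (p : ℝ) < Real.sqrt ((1 + ε) * ((x : ℝ) + 2) / p₁) := fun p₁ p hp => by
    rw [hP₂] at hp
    simp only at hp
    rw [Finset.mem_filter, Nat.mem_primesBelow] at hp
    exact ⟨hp.1.2, hp.2, Nat.lt_ceil.mp hp.1.1⟩
  -- Step A
  have hA : (#(chenTriplesExt x ε) : ℝ) ≤
      ∑ p₁ ∈ P₁, ∑ p₂ ∈ P₂ p₁, (Nat.primeCounting ⌊(1 + ε) * ((x : ℝ) + 2) / (p₁ * p₂)⌋₊ : ℝ) := by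
    have h := card_chenTriplesExt_le_sum_primeCounting (ε := ε) hxpos hε
    have h' := (Nat.cast_le (α := ℝ)).mpr h
    simp only [Nat.cast_sum] at h'
    exact h'
  -- Step B: the prime number theorem, termwise
  have hB : ∀ p₁ ∈ P₁, ∀ p₂ ∈ P₂ p₁,
      (Nat.primeCounting ⌊(1 + ε) * ((x : ℝ) + 2) / (p₁ * p₂)⌋₊ : ℝ) ≤
        (1 + ε / 4) * ((1 + ε) * ((x : ℝ) + 2)) *
          (1 / ((p₁ : ℝ) * p₂ * (Real.log x - Real.log p₁ - Real.log p₂))) := by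
    intro p₁ hp₁ p₂ hp₂
    obtain ⟨hp₁prime, hp₁z, hp₁Y⟩ := hmemP₁ p₁ hp₁
    obtain ⟨hp₂prime, hp₂Y, hp₂W⟩ := hmemP₂ p₁ p₂ hp₂
    have hp₁0 : (0 : ℝ) < p₁ := by exact_mod_cast hp₁prime.pos
    have hp₂0 : (0 : ℝ) < p₂ := by exact_mod_cast hp₂prime.pos
    have hpp : (0 : ℝ) < p₁ * p₂ := mul_pos hp₁0 hp₂0
    -- `p₁ p₂² < X₁`
    have hsq : (p₂ : ℝ) ^ 2 < (1 + ε) * ((x : ℝ) + 2) / p₁ :=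
      (Real.lt_sqrt hp₂0.le).mp hp₂W
    rw [lt_div_iff₀ hp₁0] at hsq
    -- `u = X₁/(p₁p₂) > p₂ ≥ Y' ≥ N₀ + 3`
    have hu : (N₀ : ℝ) + 3 ≤ (1 + ε) * ((x : ℝ) + 2) / (p₁ * p₂) := by
      have : (p₂ : ℝ) < (1 + ε) * ((x : ℝ) + 2) / (p₁ * p₂) := by
        rw [lt_div_iff₀ hpp]
        calc (p₂ : ℝ) * (p₁ * p₂) = (p₂ : ℝ) ^ 2 * p₁ := by ring
          _ < (1 + ε) * ((x : ℝ) + 2) := hsq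
      linarith
    -- `v = x/(p₁p₂) > 1`
    have hv : 1 < (x : ℝ) / (p₁ * p₂) := by
      rw [lt_div_iff₀ hpp, one_mul]
      -- `3 p₁ p₂ ≤ p₁ p₂² < X₁ ≤ 2.1 x`
      have h1 : (p₁ : ℝ) * p₂ * p₂ < (1 + ε) * ((x : ℝ) + 2) := by
        calc (p₁ : ℝ) * p₂ * p₂ = (p₂ : ℝ) ^ 2 * p₁ := by ring
          _ < (1 + ε) * ((x : ℝ) + 2) := hsq
      have h2 : (p₁ : ℝ) * p₂ * 3 ≤ (p₁ : ℝ) * p₂ * p₂ := by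
        have : (3 : ℝ) ≤ p₂ := h3x13.trans (hx13.trans hp₂Y)
        exact mul_le_mul_of_nonneg_left this hpp.le
      linarith
    have hvu : (x : ℝ) / (p₁ * p₂) ≤ (1 + ε) * ((x : ℝ) + 2) / (p₁ * p₂) :=
      div_le_div_of_nonneg_right hX₁ge hpp.le
    have h := primeCounting_floor_le hη₁.le hPNT hv hvu hu
    have hlogv : Real.log ((x : ℝ) / (p₁ * p₂)) = Real.log x - Real.log p₁ - Real.log p₂ := by
      rw [Real.log_div hX0.ne' hpp.ne', Real.log_mul hp₁0.ne' hp₂0.ne']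
      ring
    have hlogv0 : 0 < Real.log x - Real.log p₁ - Real.log p₂ := by
      rw [← hlogv]; exact Real.log_pos hv
    rw [hlogv] at h
    refine h.trans (le_of_eq ?_)
    field_simp
  -- Step C: the double prime sum
  have hC : ∑ p₁ ∈ P₁, ∑ p₂ ∈ P₂ p₁,
      1 / ((p₁ : ℝ) * p₂ * (Real.log x - Real.log p₁ - Real.log p₂)) ≤
      (switchingConstant + 16 / N + 2100 * N / Real.log x) / Real.log x :=
    double_prime_sum_le (X₁ := (1 + ε) * ((x : ℝ) + 2)) (Y' := ((x : ℝ) + 3) ^ (1 / 3 : ℝ))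
      hX1 hL400 hz3 hY3 hx13 haY' hX₁ge hX₁' hN
  -- assemble
  have hsum : (#(chenTriplesExt x ε) : ℝ) ≤ (1 + ε / 4) * ((1 + ε) * ((x : ℝ) + 2)) *
      ∑ p₁ ∈ P₁, ∑ p₂ ∈ P₂ p₁, 1 / ((p₁ : ℝ) * p₂ * (Real.log x - Real.log p₁ - Real.log p₂)) := by
    refine hA.trans ?_
    rw [Finset.mul_sum]
    refine Finset.sum_le_sum fun p₁ hp₁ => ?_
    rw [Finset.mul_sum]
    exact Finset.sum_le_sum fun p₂ hp₂ => hB p₁ hp₁ p₂ hp₂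
  have hcη : switchingConstant + 16 / N + 2100 * N / Real.log x ≤ switchingConstant + η := by
    have h1 : 2100 * N / Real.log x ≤ η / 2 := by
      rw [div_le_iff₀ hL0]
      rw [div_le_iff₀ hη] at hLN
      linarith
    linarith
  have hc0 : 0 ≤ switchingConstant := switchingConstant_nonneg
  have hcN0 : 0 ≤ (switchingConstant + 16 / N + 2100 * N / Real.log x) / Real.log x :=
    div_nonneg (add_nonneg (add_nonneg hc0 (by positivity)) (by positivity)) hL0.le
  have hfactor : (1 + ε / 4) * ((1 + ε) * ((x : ℝ) + 2)) ≤ (1 + 2 * ε) * x := by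
    have e1 : (1 + ε / 4) * (1 + ε) ≤ 1 + 3 / 2 * ε := by nlinarith only [hε, hε1]
    have e2 : (1 + 3 / 2 * ε) * ((x : ℝ) + 2) ≤ (1 + 2 * ε) * x := by linarith
    calc (1 + ε / 4) * ((1 + ε) * ((x : ℝ) + 2)) = ((1 + ε / 4) * (1 + ε)) * ((x : ℝ) + 2) := by ring
      _ ≤ (1 + 3 / 2 * ε) * ((x : ℝ) + 2) := mul_le_mul_of_nonneg_right e1 (by positivity)
      _ ≤ (1 + 2 * ε) * x := e2
  calc (#(chenTriplesExt x ε) : ℝ)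
      ≤ (1 + ε / 4) * ((1 + ε) * ((x : ℝ) + 2)) *
          ∑ p₁ ∈ P₁, ∑ p₂ ∈ P₂ p₁, 1 / ((p₁ : ℝ) * p₂ * (Real.log x - Real.log p₁ - Real.log p₂)) := hsum
    _ ≤ (1 + ε / 4) * ((1 + ε) * ((x : ℝ) + 2)) *
          ((switchingConstant + 16 / N + 2100 * N / Real.log x) / Real.log x) :=
        mul_le_mul_of_nonneg_left hC (by positivity)
    _ ≤ (1 + 2 * ε) * x * ((switchingConstant + η) / Real.log x) :=
        mul_le_mul hfactor (div_le_div_of_nonneg_right hcη hL0.le) hcN0 (by positivity)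
    _ = (1 + 2 * ε) * (switchingConstant + η) * x / Real.log x := by ring

end Literature.NumberTheory.Sieve.Chen
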